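import Summits.QuantumFields.YangMills.Theorems.FradkinShenkerFlowPoincareToClusteringGap
import Summits.QuantumFields.YangMills.Theorems.FradkinShenkerFlowPoincareToClusteringGeometry

/-!
# Finite speed of propagation of the random-scan heat bath (oscillation bounds)

Route `FradkinShenkerFlow` of `YangMills`, support item `stmt-QuantumFields-9444`
(`Summit.QuantumFields.YangMills.Theses.FradkinShenkerFlow.PoincareToClustering`, UP ⇒ EC).

The **oscillation** of an observable `h` along the link `ℓ` is `sup_{U,g} |h(U[ℓ↦g]) − h(U)|`;
`osc h ℓ` (file `…Defs`; a real supremum, meaningful for bounded `h`). This file proves the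
β-INDEPENDENT finite speed of propagation of the single-link heat bath of the torus Wilson
theory in oscillation form:

* `osc_hbOp_le` — one heat-bath resampling `E_{ℓ'}` (file `…HeatBath`): the oscillation along `ℓ`
  of `E_{ℓ'} h` is at most `v ℓ + 2·[ℓ ∈ linkNbhd ℓ']·v ℓ'` (LOCALITY `hbLaw_congr` of the law of
  `ℓ'`, which reads only `linkNbhd ℓ'`);
* `osc_scanOp_le` — for the random scan `K = |E|⁻¹ ∑ E_{ℓ'}`:
  `osc(K h) ≤ (1 + 2|E|⁻¹ A) osc(h)` componentwise, `A` the adjacency matrix of `linkNbhd`;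
* `osc_scanIter_le_geom` — EXPONENTIAL WEIGHTS: if `osc_ℓ(h) ≤ A a^{tdist c ℓ}` (`0 < a ≤ 1`) then
  `osc_ℓ(K^j h) ≤ A (1 + 2D/(a|E|))^j a^{tdist c ℓ}`, `D = (d+1)(d+d²)`; with `j = k|E|` steps the
  growth factor is `≤ exp(2Dk/a)`, uniformly in the volume — the light cone of the heat bath.

References: F. Martinelli, LNM 1717 (1999), §3 (finite speed of propagation for finite-range
Glauber dynamics); T. Liggett, *Interacting Particle Systems* (2005), Ch. I §3–4.
-/

noncomputable section

open MeasureTheory ProbabilityTheory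
open Literature.MathematicalPhysics.QuantumFieldTheory

namespace Summit.QuantumFields.YangMills.Theorems.PoincareClustering

/-! ### Oscillation bounds -/

section OscDef

variable {d L : ℕ} {G : Type*}

/-- The defining bound of the oscillation (bounded `h`). [folklore] -/
theorem abs_sub_le_osc {h : GaugeConfig d L G → ℝ} {M : ℝ} (hM : ∀ V, |h V| ≤ M) (ℓ : Edge d L)
    (U : GaugeConfig d L G) (g : G) : |h (Function.update U ℓ g) - h U| ≤ osc h ℓ :=
  le_ciSup (f := fun p : GaugeConfig d L G × G => |h (Function.update p.1 ℓ p.2) - h p.1|)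
    ⟨M + M, by
      rintro _ ⟨p, rfl⟩
      exact (abs_sub _ _).trans (add_le_add (hM _) (hM _))⟩ (U, g)

/-- The oscillation is the least such bound. [folklore] -/
theorem osc_le [Group G] {h : GaugeConfig d L G → ℝ} {ℓ : Edge d L} {c : ℝ}
    (hc : ∀ (U : GaugeConfig d L G) (g : G), |h (Function.update U ℓ g) - h U| ≤ c) :
    osc h ℓ ≤ c :=
  ciSup_le fun p => hc p.1 p.2

/-- Oscillations are nonnegative. [folklore] -/
theorem osc_nonneg (h : GaugeConfig d L G → ℝ) (ℓ : Edge d L) : 0 ≤ osc h ℓ :=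
  Real.iSup_nonneg fun _ => abs_nonneg _

/-- Subtracting a constant does not change oscillations. [folklore] -/
theorem osc_sub_const (h : GaugeConfig d L G → ℝ) (c : ℝ) (ℓ : Edge d L) :
    osc (fun U => h U - c) ℓ = osc h ℓ := by
  unfold osc
  simp only [sub_sub_sub_cancel_right]

end OscDef

section Oscillation

variable {d L N : ℕ} {G : Type*} [Group G] [TopologicalSpace G] [IsTopologicalGroup G]
  [CompactSpace G] [MeasurableSpace G] [BorelSpace G] [NeZero L]
  (ρ : G →* Matrix (Fin N) (Fin N) ℂ) (β : ℝ)

variable [SecondCountableTopology G]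

/-- **One heat-bath resampling propagates oscillations only along the link neighbourhood**:
if `osc_ℓ(h) ≤ v ℓ` for all `ℓ`, then
`osc_ℓ(E_{ℓ'} h) ≤ v ℓ + 2 [ℓ ∈ linkNbhd ℓ'] v ℓ'` — by locality of the law of `ℓ'`
(`hbLaw_congr`) the second term only appears when `ℓ` is a neighbour of `ℓ'`
(Martinelli 1999 §3, finite speed of propagation, one step). [folklore] -/
theorem osc_hbOp_le (hρ : Continuous ρ) {h : GaugeConfig d L G → ℝ} (hh : Measurable h)
    {M : ℝ} (hM : ∀ V, |h V| ≤ M) {v : Edge d L → ℝ} (hv : ∀ ℓ, osc h ℓ ≤ v ℓ)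
    (ℓ' ℓ : Edge d L) :
    osc (hbOp ρ β ℓ' h) ℓ ≤ v ℓ + if ℓ ∈ linkNbhd ℓ' then 2 * v ℓ' else 0 := by
  have hv' : ∀ (ℓ : Edge d L) (U : GaugeConfig d L G) (g : G),
      |h (Function.update U ℓ g) - h U| ≤ v ℓ := fun ℓ U g => (abs_sub_le_osc hM ℓ U g).trans (hv ℓ)
  have hv0 : ∀ ℓ, 0 ≤ v ℓ := fun ℓ => (osc_nonneg h ℓ).trans (hv ℓ)
  have hite : 0 ≤ (if ℓ ∈ linkNbhd ℓ' then 2 * v ℓ' else 0) := by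
    split_ifs
    · exact mul_nonneg (by norm_num) (hv0 ℓ')
    · exact le_rfl
  refine osc_le fun U g => ?_
  by_cases hℓ : ℓ = ℓ'
  · subst hℓ
    rw [hbOp_update, sub_self, abs_zero]
    exact add_nonneg (hv0 ℓ) hite
  · haveI := isProbabilityMeasure_hbLaw ρ β hρ ℓ' (Function.update U ℓ g)
    haveI := isProbabilityMeasure_hbLaw ρ β hρ ℓ' U
    have hcomm : ∀ g', Function.update (Function.update U ℓ g) ℓ' g' =
        Function.update (Function.update U ℓ' g') ℓ g := fun g' => Function.update_comm hℓ _ _ _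
    have i1 : Integrable (fun g' => h (Function.update (Function.update U ℓ g) ℓ' g'))
        (hbLaw ρ β ℓ' (Function.update U ℓ g)) :=
      integrable_of_measurable_of_abs_le (hh.comp (measurable_update _)) (fun g' => hM _)
    have i2 : Integrable (fun g' => h (Function.update U ℓ' g'))
        (hbLaw ρ β ℓ' (Function.update U ℓ g)) :=
      integrable_of_measurable_of_abs_le (hh.comp (measurable_update _)) (fun g' => hM _)
    have i3 : Integrable (fun g' => h (Function.update U ℓ' g')) (hbLaw ρ β ℓ' U) :=
      integrable_of_measurable_of_abs_le (hh.comp (measurable_update _)) (fun g' => hM _)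
    have e : hbOp ρ β ℓ' h (Function.update U ℓ g) - hbOp ρ β ℓ' h U =
        (∫ g', (h (Function.update (Function.update U ℓ g) ℓ' g') - h (Function.update U ℓ' g'))
            ∂(hbLaw ρ β ℓ' (Function.update U ℓ g))) +
          ((∫ g', h (Function.update U ℓ' g') ∂(hbLaw ρ β ℓ' (Function.update U ℓ g))) -
            ∫ g', h (Function.update U ℓ' g') ∂(hbLaw ρ β ℓ' U)) := by
      unfold hbOp
      rw [integral_sub i1 i2]
      ring
    -- term 1: oscillation along `ℓ`
    have b1 : |∫ g', (h (Function.update (Function.update U ℓ g) ℓ' g') -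
        h (Function.update U ℓ' g')) ∂(hbLaw ρ β ℓ' (Function.update U ℓ g))| ≤ v ℓ := by
      have := norm_integral_le_of_norm_le_const (μ := hbLaw ρ β ℓ' (Function.update U ℓ g))
        (f := fun g' => h (Function.update (Function.update U ℓ g) ℓ' g') -
          h (Function.update U ℓ' g')) (C := v ℓ)
        (ae_of_all _ fun g' => by rw [Real.norm_eq_abs, hcomm]; exact hv' ℓ _ g)
      simpa only [Real.norm_eq_abs, probReal_univ, mul_one] using this
    -- term 2: change of the law of `ℓ'`, only if `ℓ` is a neighbour of `ℓ'`
    have b2 : |(∫ g', h (Function.update U ℓ' g') ∂(hbLaw ρ β ℓ' (Function.update U ℓ g))) -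
        ∫ g', h (Function.update U ℓ' g') ∂(hbLaw ρ β ℓ' U)| ≤
        if ℓ ∈ linkNbhd ℓ' then 2 * v ℓ' else 0 := by
      split_ifs with hmem
      · have hosc : ∀ g₁ g₂, |h (Function.update U ℓ' g₁) - h (Function.update U ℓ' g₂)| ≤ v ℓ' :=
          fun g₁ g₂ => by
            have := hv' ℓ' (Function.update U ℓ' g₂) g₁
            rwa [Function.update_idem] at this
        have a1 := abs_integral_sub_apply_le i2 hosc 1
        have a2 := abs_integral_sub_apply_le i3 hosc 1
        calc |(∫ g', h (Function.update U ℓ' g') ∂(hbLaw ρ β ℓ' (Function.update U ℓ g))) -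
              ∫ g', h (Function.update U ℓ' g') ∂(hbLaw ρ β ℓ' U)|
            = |((∫ g', h (Function.update U ℓ' g') ∂(hbLaw ρ β ℓ' (Function.update U ℓ g))) -
                  h (Function.update U ℓ' 1)) -
                ((∫ g', h (Function.update U ℓ' g') ∂(hbLaw ρ β ℓ' U)) -
                  h (Function.update U ℓ' 1))| := by rw [sub_sub_sub_cancel_right]
          _ ≤ _ := abs_sub _ _
          _ ≤ v ℓ' + v ℓ' := add_le_add a1 a2
          _ = 2 * v ℓ' := by ring
      · have hag : ∀ e ∈ linkNbhd ℓ', e ≠ ℓ' → Function.update U ℓ g e = U e :=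
          fun e he _ => Function.update_of_ne (fun hel => by subst hel; exact hmem he) _ _
        rw [hbLaw_congr ρ β hag, sub_self, abs_zero]
    rw [e]
    exact (abs_add_le _ _).trans (add_le_add b1 b2)

/-- **One step of the random scan propagates oscillations along the neighbourhood graph**:
`osc_ℓ(K h) ≤ v ℓ + 2|E|⁻¹ ∑_{ℓ' ∈ linkNbhd ℓ} v ℓ'` (symmetry of `linkNbhd`). [folklore] -/
theorem osc_scanOp_le [NeZero d] (hρ : Continuous ρ) {h : GaugeConfig d L G → ℝ}
    (hh : Measurable h) {M : ℝ} (hM : ∀ V, |h V| ≤ M) {v : Edge d L → ℝ}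
    (hv : ∀ ℓ, osc h ℓ ≤ v ℓ) (ℓ : Edge d L) :
    osc (scanOp ρ β h) ℓ ≤ v ℓ + 2 * (Fintype.card (Edge d L) : ℝ)⁻¹ * ∑ ℓ' ∈ linkNbhd ℓ, v ℓ' := by
  have hv0 : ∀ ℓ, 0 ≤ v ℓ := fun ℓ => (osc_nonneg h ℓ).trans (hv ℓ)
  have hn0 : (0 : ℝ) < Fintype.card (Edge d L) := by exact_mod_cast Fintype.card_pos
  refine osc_le fun U g => ?_
  have key : scanOp ρ β h (Function.update U ℓ g) - scanOp ρ β h U =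
      (Fintype.card (Edge d L) : ℝ)⁻¹ *
        ∑ ℓ', (hbOp ρ β ℓ' h (Function.update U ℓ g) - hbOp ρ β ℓ' h U) := by
    unfold scanOp
    rw [← mul_sub, Finset.sum_sub_distrib]
  have hterm : ∀ ℓ', |hbOp ρ β ℓ' h (Function.update U ℓ g) - hbOp ρ β ℓ' h U| ≤
      v ℓ + if ℓ ∈ linkNbhd ℓ' then 2 * v ℓ' else 0 := fun ℓ' =>
    (abs_sub_le_osc (abs_hbOp_le ρ β hρ ℓ' hM) ℓ U g).trans (osc_hbOp_le ρ β hρ hh hM hv ℓ' ℓ)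
  have hsub : ∑ ℓ' ∈ Finset.univ.filter (fun ℓ' => ℓ ∈ linkNbhd ℓ'), v ℓ' ≤
      ∑ ℓ' ∈ linkNbhd ℓ, v ℓ' :=
    Finset.sum_le_sum_of_subset_of_nonneg
      (fun ℓ' h' => linkNbhd_symm (Finset.mem_filter.1 h').2) (fun _ _ _ => hv0 _)
  have h2 : (2 : ℝ) * ∑ ℓ' ∈ Finset.univ.filter (fun ℓ' => ℓ ∈ linkNbhd ℓ'), v ℓ' ≤
      2 * ∑ ℓ' ∈ linkNbhd ℓ, v ℓ' := mul_le_mul_of_nonneg_left hsub (by norm_num)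
  have hinv : (0 : ℝ) ≤ (Fintype.card (Edge d L) : ℝ)⁻¹ := by positivity
  rw [key, abs_mul, abs_inv, Nat.abs_cast]
  calc (Fintype.card (Edge d L) : ℝ)⁻¹ *
        |∑ ℓ', (hbOp ρ β ℓ' h (Function.update U ℓ g) - hbOp ρ β ℓ' h U)|
      ≤ (Fintype.card (Edge d L) : ℝ)⁻¹ *
          ∑ ℓ', (v ℓ + if ℓ ∈ linkNbhd ℓ' then 2 * v ℓ' else 0) :=
        mul_le_mul_of_nonneg_left ((Finset.abs_sum_le_sum_abs _ _).trans
          (Finset.sum_le_sum fun ℓ' _ => hterm ℓ')) hinv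
    _ = (Fintype.card (Edge d L) : ℝ)⁻¹ * ((Fintype.card (Edge d L) : ℝ) * v ℓ +
          2 * ∑ ℓ' ∈ Finset.univ.filter (fun ℓ' => ℓ ∈ linkNbhd ℓ'), v ℓ') := by
        rw [Finset.sum_add_distrib, Finset.sum_const, Finset.card_univ, nsmul_eq_mul,
          Finset.sum_filter, Finset.mul_sum]
        congr 2
        exact Finset.sum_congr rfl fun ℓ' _ => by split_ifs <;> simp
    _ ≤ (Fintype.card (Edge d L) : ℝ)⁻¹ * ((Fintype.card (Edge d L) : ℝ) * v ℓ +
          2 * ∑ ℓ' ∈ linkNbhd ℓ, v ℓ') :=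
        mul_le_mul_of_nonneg_left (add_le_add le_rfl h2) hinv
    _ = v ℓ + 2 * (Fintype.card (Edge d L) : ℝ)⁻¹ * ∑ ℓ' ∈ linkNbhd ℓ, v ℓ' := by
        field_simp

/-- **Exponential weights are propagated with a volume-uniform factor**: if
`osc_ℓ(h) ≤ A a^{tdist c ℓ}` with `0 < a ≤ 1`, then
`osc_ℓ(K h) ≤ A (1 + 2 D / (a |E|)) a^{tdist c ℓ}`, `D = (d+1)(d+d²) ≥ |linkNbhd ℓ|`
(neighbours have `tdist` differing by at most one). [folklore] -/
theorem osc_scanOp_le_geom [NeZero d] (hρ : Continuous ρ) {h : GaugeConfig d L G → ℝ}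
    (hh : Measurable h) {M : ℝ} (hM : ∀ V, |h V| ≤ M) (c : ZMod L) {a A : ℝ} (ha0 : 0 < a)
    (ha1 : a ≤ 1) (hA : 0 ≤ A) (hv : ∀ ℓ, osc h ℓ ≤ A * a ^ tdist c ℓ) (ℓ : Edge d L) :
    osc (scanOp ρ β h) ℓ ≤
      (A * (1 + 2 * ((d + 1) * (d + d * d) : ℕ) / (a * Fintype.card (Edge d L)))) *
        a ^ tdist c ℓ := by
  have hn0 : (0 : ℝ) < Fintype.card (Edge d L) := by exact_mod_cast Fintype.card_pos
  refine (osc_scanOp_le ρ β hρ hh hM hv ℓ).trans ?_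
  have hsum : ∑ ℓ' ∈ linkNbhd ℓ, A * a ^ tdist c ℓ' ≤
      ((d + 1) * (d + d * d) : ℕ) * (A * a ^ tdist c ℓ / a) := by
    calc ∑ ℓ' ∈ linkNbhd ℓ, A * a ^ tdist c ℓ' ≤ ∑ _ℓ' ∈ linkNbhd ℓ, A * a ^ tdist c ℓ / a :=
          Finset.sum_le_sum fun ℓ' h' => by
            rw [le_div_iff₀ ha0, mul_assoc, ← pow_succ]
            exact mul_le_mul_of_nonneg_left
              (pow_le_pow_of_le_one ha0.le ha1 (tdist_le_of_mem_linkNbhd c h').2) hA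
      _ = (linkNbhd ℓ).card * (A * a ^ tdist c ℓ / a) := by
          rw [Finset.sum_const, nsmul_eq_mul]
      _ ≤ _ := mul_le_mul_of_nonneg_right (by exact_mod_cast card_linkNbhd_le ℓ) (by positivity)
  have hinv : (0 : ℝ) ≤ 2 * (Fintype.card (Edge d L) : ℝ)⁻¹ := by positivity
  have hstep : 2 * (Fintype.card (Edge d L) : ℝ)⁻¹ * ∑ ℓ' ∈ linkNbhd ℓ, A * a ^ tdist c ℓ' ≤
      2 * (Fintype.card (Edge d L) : ℝ)⁻¹ * (((d + 1) * (d + d * d) : ℕ) * (A * a ^ tdist c ℓ / a)) :=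
    mul_le_mul_of_nonneg_left hsum hinv
  have hfin : A * a ^ tdist c ℓ +
      2 * (Fintype.card (Edge d L) : ℝ)⁻¹ * (((d + 1) * (d + d * d) : ℕ) * (A * a ^ tdist c ℓ / a)) =
      (A * (1 + 2 * ((d + 1) * (d + d * d) : ℕ) / (a * Fintype.card (Edge d L)))) *
        a ^ tdist c ℓ := by
    field_simp
  calc A * a ^ tdist c ℓ + 2 * (Fintype.card (Edge d L) : ℝ)⁻¹ * ∑ ℓ' ∈ linkNbhd ℓ, A * a ^ tdist c ℓ'
      ≤ A * a ^ tdist c ℓ + 2 * (Fintype.card (Edge d L) : ℝ)⁻¹ *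
          (((d + 1) * (d + d * d) : ℕ) * (A * a ^ tdist c ℓ / a)) := add_le_add le_rfl hstep
    _ = _ := hfin

/-- **Finite speed of propagation of the random-scan heat bath** (iterated form): if
`osc_ℓ(h) ≤ A a^{tdist c ℓ}` then `osc_ℓ(K^j h) ≤ A (1 + 2D/(a|E|))^j a^{tdist c ℓ}`. With
`j = k|E|` steps (`k` units of Glauber time) the factor is at most `exp(2Dk/a)`, uniformly in
the volume (Martinelli 1999 §3). [folklore] -/
theorem osc_scanIter_le_geom [NeZero d] (hρ : Continuous ρ) {h : GaugeConfig d L G → ℝ}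
    (hh : Measurable h) {M : ℝ} (hM : ∀ V, |h V| ≤ M) (c : ZMod L) {a A : ℝ} (ha0 : 0 < a)
    (ha1 : a ≤ 1) (hA : 0 ≤ A) (hv : ∀ ℓ, osc h ℓ ≤ A * a ^ tdist c ℓ) (j : ℕ) (ℓ : Edge d L) :
    osc (scanIter ρ β j h) ℓ ≤
      (A * (1 + 2 * ((d + 1) * (d + d * d) : ℕ) / (a * Fintype.card (Edge d L))) ^ j) *
        a ^ tdist c ℓ := by
  have hn0 : (0 : ℝ) < Fintype.card (Edge d L) := by exact_mod_cast Fintype.card_pos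
  induction j generalizing ℓ with
  | zero => simpa only [scanIter_zero, pow_zero, mul_one] using hv ℓ
  | succ j ih =>
    have hAj : 0 ≤ A * (1 + 2 * ((d + 1) * (d + d * d) : ℕ) / (a * Fintype.card (Edge d L))) ^ j := by
      positivity
    have step := osc_scanOp_le_geom ρ β hρ (measurable_scanIter ρ β hρ hh j)
      (abs_scanIter_le ρ β hρ hM j) c ha0 ha1 hAj ih ℓ
    rw [scanIter_succ]
    refine step.trans_eq ?_
    ring

omit [SecondCountableTopology G] in
/-- The growth factor over `k |E|` steps is volume-uniform: `(1 + x/|E|)^{k|E|} ≤ exp(x k)` for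
`x ≥ 0`. [folklore] -/
theorem one_add_div_pow_mul_le_exp {x : ℝ} (hx : 0 ≤ x) {n : ℕ} (hn : 0 < n) (k : ℕ) :
    (1 + x / n) ^ (k * n) ≤ Real.exp (x * k) := by
  have h1 : 1 + x / n ≤ Real.exp (x / n) := by
    have := Real.add_one_le_exp (x / n)
    linarith
  have h0 : 0 ≤ 1 + x / n := by positivity
  calc (1 + x / n) ^ (k * n) ≤ Real.exp (x / n) ^ (k * n) := pow_le_pow_left₀ h0 h1 _
    _ = Real.exp (x * k) := by
        rw [← Real.exp_nat_mul]
        congr 1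
        have hn' : (n : ℝ) ≠ 0 := by exact_mod_cast hn.ne'
        push_cast
        field_simp

end Oscillation

end Summit.QuantumFields.YangMills.Theorems.PoincareClustering

end
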